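import Mathlib
import Summits.Ventures.PercRepro2.ExplorationTreeCov
import Summits.Ventures.PercRepro2.ExplorationTreeGraft

/-!
# The between term along the exploration filtration, one step at a time (blind cell PercRepro2,
typer-1 g21; a language line)

`ExplorationTreeCov.lean` split a covariance along the leaves of a stopping exploration `t`:
`cov[f, g] = WITHIN(t) + BETWEEN(t)` with `BETWEEN(t) = cov[leafMean t f, leafMean t g]`.
`ExplorationTreeGraft.lean` continued `t` at each leaf `ℓ` by a tree `k ℓ` (the exploration
filtration).  This file computes how the BETWEEN term moves along the filtration:

* `prob_event_eq_mul_of_mem_leaves`: the probability of a leaf of a continuation factors through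
  the leaf it continues, `P_p(ℓ') = P_p(ℓ) · P_{pin p ℓ}(ℓ')`;
* **`covariance_leafMean_graft`** (the exploration increment of the between term):
  `BETWEEN(graft t k) = BETWEEN(t)
    + Σ_{ℓ ∈ leaves t} P_p(ℓ) · Σ_{ℓ' ∈ leaves (k ℓ) ℓ} P_{pin ℓ}(ℓ')
        (E_{pin ℓ'} f − E_{pin ℓ} f)(E_{pin ℓ'} g − E_{pin ℓ} g)`
  — the increment is the leaf-weighted sum of the between terms of the continuations, each a
  covariance of pinned means under the pinned law of its leaf (`covariance_leafMean_pin`);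
  equivalently (`within_graft`) the WITHIN term decreases by the same amount;
* **`between_step_one_node`** / **`covariance_leafMean_graft_one_node`** (one edge at a time):
  revealing one unexplored edge `e` at the leaf `ℓ` adds exactly
  `P_p(ℓ) · p_e (1 − p_e) · (E_{ℓ, e↦1} f − E_{ℓ, e↦0} f)(E_{ℓ, e↦1} g − E_{ℓ, e↦0} g)`
  to the between term (the edge split `EdgeSplit.covariance_eq_pin` at the pinned law);
  `between_step_one_node_nonneg_iff`: for `0 < p_e < 1` that step is `≥ 0` iff the two pinned
  increments of `f` and `g` across `e` have the same sign.

Identities only (plus the one sign reading); nothing about the sign of any increment.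
-/

namespace Summit.Ventures.PercRepro2

open MeasureTheory ProbabilityTheory MeasureBridge

namespace ExplorationTree

/-! ## Leaves of a continuation under the pinned law -/

section Leaves

variable {E : Type*} [Fintype E] [DecidableEq E]

/-- The pinned law of a partial configuration lives on its event: `P_{pin p P}(P.event ∩ A) =
`P_{pin p P}(A)`. -/
lemma prob_pin_inter_event (p : E → ℝ) (P : Partial E) (A : Set (Config E)) :
    prob (pin p P) (P.event ∩ A) = prob (pin p P) A := by
  rw [prob_eq_expect_indicator, prob_eq_expect_indicator]
  refine expect_pin_congr p P fun ω hω => ?_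
  by_cases hA : ω ∈ A
  · rw [Set.indicator_of_mem (show ω ∈ P.event ∩ A from ⟨hω, hA⟩), Set.indicator_of_mem hA]
  · rw [Set.indicator_of_notMem (fun h => hA h.2), Set.indicator_of_notMem hA]

/-- The pinned law gives its own event full mass. -/
lemma prob_pin_event_self (p : E → ℝ) (P : Partial E) : prob (pin p P) P.event = 1 := by
  have h := prob_pin_inter_event p P Set.univ
  rw [Set.inter_univ] at h
  rw [h, prob_eq_expect_indicator, Set.indicator_univ]
  exact expect_const (pin p P) 1

/-- The leaf weights of a valid continuation started at `P` sum to one under the pinned law of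
`P`. -/
lemma sum_leaves_prob_pin (p : E → ℝ) (t : ETree E) (P : Partial E) (hv : Valid t P.F) :
    ((leaves t P).map fun ℓ => prob (pin p P) ℓ.event).sum = 1 := by
  have h := expect_pin_eq_sum_leaves_pin p t P hv (fun _ => (1 : ℝ))
  rw [expect_const] at h
  rw [h]
  congr 1
  refine List.map_congr_left fun ℓ _ => ?_
  rw [expect_const, mul_one]

/-- **The probability of a leaf of a continuation factors through the leaf it continues**:
`P_p(ℓ') = P_p(ℓ) · P_{pin p ℓ}(ℓ')` for `ℓ' ∈ leaves t ℓ` (`t` valid at `ℓ`). -/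
lemma prob_event_eq_mul_of_mem_leaves (p : E → ℝ) (t : ETree E) (P : Partial E)
    (hv : Valid t P.F) {ℓ : Partial E} (hℓ : ℓ ∈ leaves t P) :
    prob p ℓ.event = prob p P.event * prob (pin p P) ℓ.event := by
  rw [← prob_event_inter]
  congr 1
  exact (Set.inter_eq_right.mpr (event_subset_of_mem_leaves t P hv ℓ hℓ)).symm

/-- The between term of a continuation under the pinned law of its root, centred:
`cov[leafMean_{pin ℓ} f, leafMean_{pin ℓ} g; μ_{pin p ℓ}]` is the leaf-weighted sum of the centred
products — the `P = ℓ` form of `covariance_leafMean_centered` (here `leafMean` is the pinned mean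
of the continuation read from the leaf of `t` it continues). -/
theorem covariance_leafMean_pin (p : E → ℝ) (hp : IsProbVec p) (t : ETree E) (P : Partial E)
    (hv : Valid t P.F) (f g : Config E → ℝ) :
    cov[fun ω => expect (pin p (leafOf t P ω)) f, fun ω => expect (pin p (leafOf t P ω)) g;
        percMeasureOf (pin p P) (isProbVec_pin hp P)] =
      ((leaves t P).map fun ℓ => prob (pin p P) ℓ.event *
        ((expect (pin p ℓ) f - expect (pin p P) f) *
          (expect (pin p ℓ) g - expect (pin p P) g))).sum := by
  classical
  simp only [EdgeSplit.covariance_percMeasureOf]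
  -- each of the three pinned expectations is a leaf sum
  have hsum : ∀ h : Partial E → ℝ,
      expect (pin p P) (fun ω => h (leafOf t P ω)) =
        ((leaves t P).map fun ℓ => prob (pin p P) ℓ.event * h ℓ).sum := by
    intro h
    have h1 := expect_indicator_preimage_leafOf (pin p P) t P hv Set.univ
      (fun ω => h (leafOf t P ω))
    rw [Set.preimage_univ, Set.univ_inter, expect_pin_indicator_event] at h1
    rw [h1]
    congr 1
    refine List.map_congr_left fun ℓ hℓ => ?_
    rw [if_pos (Set.mem_univ ℓ), expect_indicator_event,
      pin_pin p P ℓ (subset_of_mem_leaves t P ℓ hℓ)]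
    congr 1
    rw [expect_pin_congr p ℓ (f := fun ω => h (leafOf t P ω)) (g := fun _ => h ℓ)
      (fun ω hω => by rw [leafOf_eq_of_mem_event t P hv ℓ hℓ ω hω]), expect_const]
  rw [hsum (fun ℓ => expect (pin p ℓ) f * expect (pin p ℓ) g), hsum (fun ℓ => expect (pin p ℓ) f),
    hsum (fun ℓ => expect (pin p ℓ) g), sum_map_mul_sub_mul_sub, sum_leaves_prob_pin p t P hv,
    expect_pin_eq_sum_leaves_pin p t P hv f, expect_pin_eq_sum_leaves_pin p t P hv g]
  ring

end Leaves

/-! ## The exploration increment of the between term -/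

section Step

variable {E : Type*} [Fintype E] [DecidableEq E]

/-- **The between term along the exploration filtration**: continuing the stopping exploration
`t` at each leaf `ℓ` by a valid tree `k ℓ`,
`cov[leafMean (graft t k) f, leafMean (graft t k) g; μ_p] = cov[leafMean t f, leafMean t g; μ_p]
  + Σ_{ℓ ∈ leaves t} P_p(ℓ) · Σ_{ℓ' ∈ leaves (k ℓ) ℓ} P_{pin ℓ}(ℓ')
      (E_{pin ℓ'} f − E_{pin ℓ} f)(E_{pin ℓ'} g − E_{pin ℓ} g)`:
the increment is the leaf-weighted sum of the centred between terms of the continuations. -/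
theorem covariance_leafMean_graft (p : E → ℝ) (hp : IsProbVec p) (t : ETree E)
    (k : Partial E → ETree E) (hv : Valid t ∅) (hk : ∀ ℓ ∈ leaves t root, Valid (k ℓ) ℓ.F)
    (f g : Config E → ℝ) :
    cov[leafMean p (graft t root k) f, leafMean p (graft t root k) g; percMeasureOf p hp] =
      cov[leafMean p t f, leafMean p t g; percMeasureOf p hp] +
      ((leaves t root).map fun ℓ => prob p ℓ.event *
        ((leaves (k ℓ) ℓ).map fun ℓ' => prob (pin p ℓ) ℓ'.event *
          ((expect (pin p ℓ') f - expect (pin p ℓ) f) *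
            (expect (pin p ℓ') g - expect (pin p ℓ) g))).sum).sum := by
  have hvg : Valid (graft t root k) ∅ := valid_graft t root k hv hk
  rw [covariance_leafMean p hp _ hvg f g, covariance_leafMean p hp t hv f g, leaves_graft t root k,
    List.map_flatMap, List.flatMap_def, List.sum_flatten, List.map_map]
  have hleaf : ∀ ℓ ∈ leaves t root,
      (List.sum ∘ fun ℓ => (leaves (k ℓ) ℓ).map fun ℓ' =>
          prob p ℓ'.event * (expect (pin p ℓ') f * expect (pin p ℓ') g)) ℓ =
        prob p ℓ.event * (expect (pin p ℓ) f * expect (pin p ℓ) g) +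
        prob p ℓ.event * ((leaves (k ℓ) ℓ).map fun ℓ' => prob (pin p ℓ) ℓ'.event *
          ((expect (pin p ℓ') f - expect (pin p ℓ) f) *
            (expect (pin p ℓ') g - expect (pin p ℓ) g))).sum := by
    intro ℓ hℓ
    have hkℓ := hk ℓ hℓ
    simp only [Function.comp_apply]
    have h1 : ((leaves (k ℓ) ℓ).map fun ℓ' =>
        prob p ℓ'.event * (expect (pin p ℓ') f * expect (pin p ℓ') g)).sum =
        prob p ℓ.event * ((leaves (k ℓ) ℓ).map fun ℓ' =>
          prob (pin p ℓ) ℓ'.event * (expect (pin p ℓ') f * expect (pin p ℓ') g)).sum := by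
      rw [← List.sum_map_mul_left]
      congr 1
      refine List.map_congr_left fun ℓ' hℓ' => ?_
      rw [prob_event_eq_mul_of_mem_leaves p (k ℓ) ℓ hkℓ hℓ']
      ring
    rw [h1, sum_map_mul_sub_mul_sub, ← expect_pin_eq_sum_leaves_pin p (k ℓ) ℓ hkℓ f,
      ← expect_pin_eq_sum_leaves_pin p (k ℓ) ℓ hkℓ g, sum_leaves_prob_pin p (k ℓ) ℓ hkℓ]
    ring
  rw [List.map_congr_left hleaf, List.sum_map_add]
  ring

/-- **The WITHIN term moves by the opposite amount**: the leaf-weighted sum of the pinned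
covariances of the graft is that of `t` minus the increment of the between term. -/
theorem within_graft (p : E → ℝ) (hp : IsProbVec p) (t : ETree E)
    (k : Partial E → ETree E) (hv : Valid t ∅) (hk : ∀ ℓ ∈ leaves t root, Valid (k ℓ) ℓ.F)
    (f g : Config E → ℝ) :
    ((leaves (graft t root k) root).map fun ℓ =>
        prob p ℓ.event * cov[f, g; percMeasureOf (pin p ℓ) (isProbVec_pin hp ℓ)]).sum =
      ((leaves t root).map fun ℓ =>
        prob p ℓ.event * cov[f, g; percMeasureOf (pin p ℓ) (isProbVec_pin hp ℓ)]).sum -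
      ((leaves t root).map fun ℓ => prob p ℓ.event *
        ((leaves (k ℓ) ℓ).map fun ℓ' => prob (pin p ℓ) ℓ'.event *
          ((expect (pin p ℓ') f - expect (pin p ℓ) f) *
            (expect (pin p ℓ') g - expect (pin p ℓ) g))).sum).sum := by
  have hvg : Valid (graft t root k) ∅ := valid_graft t root k hv hk
  have h1 := covariance_eq_sum_leaves_pin_add_covariance_leafMean p hp _ hvg f g
  have h2 := covariance_eq_sum_leaves_pin_add_covariance_leafMean p hp t hv f g
  have h3 := covariance_leafMean_graft p hp t k hv hk f g
  linear_combination h2 - h1 - h3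

end Step

/-! ## One edge at a time -/

section OneEdge

variable {E : Type*} [Fintype E] [DecidableEq E]

omit [Fintype E] in
/-- Pinning on `{e open}` at `P` is the weight update of `pin p P` at `e`. -/
lemma pin_extend_true (p : E → ℝ) (P : Partial E) (e : E) :
    pin p (P.extend e true) = Function.update (pin p P) e 1 := by
  funext e'
  by_cases h : e' = e
  · subst h
    simp [pin, Partial.extend]
  · simp [pin, Partial.extend, h]

omit [Fintype E] in
/-- Pinning on `{e closed}` at `P` is the weight update of `pin p P` at `e`. -/
lemma pin_extend_false (p : E → ℝ) (P : Partial E) (e : E) :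
    pin p (P.extend e false) = Function.update (pin p P) e 0 := by
  funext e'
  by_cases h : e' = e
  · subst h
    simp [pin, Partial.extend]
  · simp [pin, Partial.extend, h]

/-- **The one-edge step of the between term**: the centred between term of the one-node
continuation `node e leaf leaf` at the leaf `ℓ` (`e ∉ ℓ.F`) is
`p_e (1 − p_e) (E_{ℓ, e↦1} f − E_{ℓ, e↦0} f)(E_{ℓ, e↦1} g − E_{ℓ, e↦0} g)`
(`E_{ℓ, e↦b}` = the expectation under `(pin p ℓ)[e ↦ b]`). -/
theorem between_step_one_node (p : E → ℝ) (ℓ : Partial E) {e : E} (he : e ∉ ℓ.F)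
    (f g : Config E → ℝ) :
    ((leaves (ETree.node e .leaf .leaf) ℓ).map fun ℓ' => prob (pin p ℓ) ℓ'.event *
        ((expect (pin p ℓ') f - expect (pin p ℓ) f) *
          (expect (pin p ℓ') g - expect (pin p ℓ) g))).sum =
      p e * (1 - p e) *
        (expect (Function.update (pin p ℓ) e 1) f - expect (Function.update (pin p ℓ) e 0) f) *
        (expect (Function.update (pin p ℓ) e 1) g - expect (Function.update (pin p ℓ) e 0) g) := by
  simp only [leaves, List.singleton_append, List.map_cons, List.map_nil, List.sum_cons,
    List.sum_nil, add_zero]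
  rw [pin_extend_true, pin_extend_false, extend_event_false ℓ he, extend_event_true ℓ he,
    prob_pin_inter_event, prob_pin_inter_event, prob_closedEdge, prob_openEdge,
    pin_of_notMem p ℓ he, expect_eq_pin (pin p ℓ) f e, expect_eq_pin (pin p ℓ) g e,
    pin_of_notMem p ℓ he]
  ring

/-- **The sign of one exploration step** (`0 < p_e < 1`): the one-edge step of the between term at
`ℓ` across `e` is `≥ 0` exactly when the two pinned increments
`E_{ℓ, e↦1} f − E_{ℓ, e↦0} f` and `E_{ℓ, e↦1} g − E_{ℓ, e↦0} g` have the same sign. -/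
theorem between_step_one_node_nonneg_iff (p : E → ℝ) (ℓ : Partial E) {e : E} (he : e ∉ ℓ.F)
    (h0 : 0 < p e) (h1 : p e < 1) (f g : Config E → ℝ) :
    0 ≤ ((leaves (ETree.node e .leaf .leaf) ℓ).map fun ℓ' => prob (pin p ℓ) ℓ'.event *
        ((expect (pin p ℓ') f - expect (pin p ℓ) f) *
          (expect (pin p ℓ') g - expect (pin p ℓ) g))).sum ↔
      0 ≤ (expect (Function.update (pin p ℓ) e 1) f - expect (Function.update (pin p ℓ) e 0) f) *
        (expect (Function.update (pin p ℓ) e 1) g - expect (Function.update (pin p ℓ) e 0) g) := by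
  rw [between_step_one_node p ℓ he f g, mul_assoc]
  exact mul_nonneg_iff_of_pos_left (mul_pos h0 (sub_pos.mpr h1))

/-- The centred between term of the trivial continuation `leaf` vanishes. -/
lemma between_leaf (p : E → ℝ) (ℓ : Partial E) (f g : Config E → ℝ) :
    ((leaves ETree.leaf ℓ).map fun ℓ' => prob (pin p ℓ) ℓ'.event *
        ((expect (pin p ℓ') f - expect (pin p ℓ) f) *
          (expect (pin p ℓ') g - expect (pin p ℓ) g))).sum = 0 := by
  simp [leaves]

omit [Fintype E] [DecidableEq E] in
/-- A partial configuration lies in its own event. -/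
lemma Partial.σ_mem_event (P : Partial E) : P.σ ∈ P.event := fun _ _ => rfl

omit [Fintype E] in
/-- **The leaves of a valid exploration are pairwise distinct** (their events are disjoint and
each contains its own observed states). -/
lemma leaves_nodup (t : ETree E) : ∀ (P : Partial E), Valid t P.F → (leaves t P).Nodup := by
  induction t with
  | leaf =>
    intro P _
    simp [leaves]
  | node e t₀ t₁ ih₀ ih₁ =>
    intro P hv
    obtain ⟨he, hv₀, hv₁⟩ := hv
    simp only [leaves]
    refine List.Nodup.append (ih₀ _ hv₀) (ih₁ _ hv₁) fun ℓ h₀ h₁ => ?_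
    have hs₀ := event_subset_of_mem_leaves t₀ _ hv₀ ℓ h₀ (Partial.σ_mem_event ℓ)
    have hs₁ := event_subset_of_mem_leaves t₁ _ hv₁ ℓ h₁ (Partial.σ_mem_event ℓ)
    rw [extend_event_false P he] at hs₀
    rw [extend_event_true P he] at hs₁
    have a : ℓ.σ e = false := hs₀.2
    have b : ℓ.σ e = true := hs₁.2
    rw [a] at b
    exact Bool.false_ne_true b

/-- A sum of `if x = a then c else 0` over a list without duplicates containing `a` is `c`. -/
lemma sum_map_ite_eq_of_nodup {α : Type*} {l : List α} (hl : l.Nodup) {a : α} (ha : a ∈ l)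
    (c : ℝ) [DecidableEq α] : (l.map fun x => if x = a then c else 0).sum = c := by
  induction l with
  | nil => simp at ha
  | cons x l ih =>
    rw [List.nodup_cons] at hl
    simp only [List.map_cons, List.sum_cons]
    rcases List.mem_cons.mp ha with h | ha'
    · subst h
      rw [if_pos rfl]
      have h0 : (l.map fun y => if y = a then c else 0).sum = 0 := by
        refine List.sum_eq_zero fun y hy => ?_
        obtain ⟨z, hz, rfl⟩ := List.mem_map.mp hy
        exact if_neg fun h : z = a => hl.1 (h ▸ hz)
      rw [h0, add_zero]
    · rw [if_neg fun h : x = a => hl.1 (h ▸ ha'), zero_add]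
      exact ih hl.2 ha'

/-- **Revealing one edge at one leaf**: for a stopping exploration `t`, a leaf `ℓ₀` of `t`, an
edge `e` unexplored at `ℓ₀`, and the continuation `k` that reveals `e` at `ℓ₀` and stops everywhere
else,
`BETWEEN(graft t k) = BETWEEN(t)
  + P_p(ℓ₀) · p_e (1 − p_e) (E_{ℓ₀, e↦1} f − E_{ℓ₀, e↦0} f)(E_{ℓ₀, e↦1} g − E_{ℓ₀, e↦0} g)`
(the leaves of a valid tree are pairwise distinct, so the step is counted once). -/
theorem covariance_leafMean_graft_one_node (p : E → ℝ) (hp : IsProbVec p) (t : ETree E)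
    (hv : Valid t ∅) {ℓ₀ : Partial E} (hℓ₀ : ℓ₀ ∈ leaves t root) {e : E} (he : e ∉ ℓ₀.F)
    (k : Partial E → ETree E) (hk₀ : k ℓ₀ = ETree.node e .leaf .leaf)
    (hk : ∀ ℓ, ℓ ≠ ℓ₀ → k ℓ = ETree.leaf) (f g : Config E → ℝ) :
    cov[leafMean p (graft t root k) f, leafMean p (graft t root k) g; percMeasureOf p hp] =
      cov[leafMean p t f, leafMean p t g; percMeasureOf p hp] +
      prob p ℓ₀.event * (p e * (1 - p e) *
        (expect (Function.update (pin p ℓ₀) e 1) f - expect (Function.update (pin p ℓ₀) e 0) f) *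
        (expect (Function.update (pin p ℓ₀) e 1) g -
          expect (Function.update (pin p ℓ₀) e 0) g)) := by
  classical
  have hkv : ∀ ℓ ∈ leaves t root, Valid (k ℓ) ℓ.F := by
    intro ℓ _
    by_cases h : ℓ = ℓ₀
    · rw [h, hk₀]
      exact ⟨he, trivial, trivial⟩
    · rw [hk ℓ h]
      trivial
  rw [covariance_leafMean_graft p hp t k hv hkv f g]
  congr 1
  -- only the chosen leaf contributes
  have hterm : ∀ ℓ ∈ leaves t root,
      prob p ℓ.event * ((leaves (k ℓ) ℓ).map fun ℓ' => prob (pin p ℓ) ℓ'.event *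
        ((expect (pin p ℓ') f - expect (pin p ℓ) f) *
          (expect (pin p ℓ') g - expect (pin p ℓ) g))).sum =
      if ℓ = ℓ₀ then prob p ℓ₀.event * (p e * (1 - p e) *
        (expect (Function.update (pin p ℓ₀) e 1) f - expect (Function.update (pin p ℓ₀) e 0) f) *
        (expect (Function.update (pin p ℓ₀) e 1) g - expect (Function.update (pin p ℓ₀) e 0) g))
      else 0 := by
    intro ℓ _
    by_cases h : ℓ = ℓ₀
    · rw [if_pos h, h, hk₀, between_step_one_node p ℓ₀ he f g]
    · rw [if_neg h, hk ℓ h, between_leaf, mul_zero]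
  rw [List.map_congr_left hterm]
  exact sum_map_ite_eq_of_nodup (leaves_nodup t root hv) hℓ₀ _

end OneEdge

end ExplorationTree

end Summit.Ventures.PercRepro2
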